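import Literature.AnabelianGeometry.SemiGraphs.TemperedGroups
import Literature.AlgebraicGeometry.Frobenioids.QuasiTemperoidConnected
import Mathlib.CategoryTheory.Comma.Over.Basic
import Mathlib.CategoryTheory.Pi.Basic
import Mathlib.Algebra.Group.Action.Sigma
import HarnessLib

/-!
# [SemiAnbd] Prop. 3.6 (v), fibrewise layer: `B^temp(Π)_S ≌ ∏_{orbits ω of S} B^temp(Π)_{S_ω}`

Mochizuki, *Semi-graphs of anabelioids*, Publ. RIMS **42** (2006) 221–322, §3, Proposition 3.6 (v),
manuscript p. 39 [cite: MochizukiSemiAnbd2006, Prop 3.6(v) p.39]: for a tempered covering `G' → G`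
(an object `S` of `B^temp(G)`), "the resulting morphism of temperoids `B^temp(G') → B^temp(G)` is
étale", i.e. `B^temp(G') ≃ B^temp(G)_S`.  Over a single constituent anabelioid `G_v = B(Π_v)` the
vertices of `G'` above `v` are the `Π_v`-orbits `ω` of the fibre `S_v` (§2 p. 23), and the statement
reduces to the decomposition of the slice category over `S_v` along these orbits followed, orbit by
orbit, by induction from the stabiliser (`B^temp(Stab) ≃ B^temp(Π)_{Π/Stab}`, the tree's
`Literature.AlgebraicGeometry.Frobenioids.QuasiTemperoid.InductionEquivalence`).

This file (abc-iut G10 ladder, item Prop 3.6 (v) = `EtaleOfTemperedCovering`, fibrewise layer; the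
global gluing along branches waits for the final form of `IsCoveringGraphOf`, seat abc-iut-L3-t2)
constructs, for ANY topological group `Π` and ANY object `S` of `B^temp(Π)`:

* `BTemp.orbitPart S ω` — the orbit `ω` of `S` as a (transitive) object of `B^temp(Π)`, with its
  inclusion `orbitPartι`;
* `BTemp.overToPi S : Over S ⥤ (∀ ω, Over (orbitPart S ω))`, `T ↦ (T ×_S S_ω)_ω` (the part of
  `T` over each orbit), and the proof that it is an EQUIVALENCE (`overToPi_isEquivalence`,
  `BTemp.overEquivPiOver`): faithful and full because a morphism over `S` is determined orbit by
  orbit, essentially surjective because a family `(U_ω → S_ω)_ω` glues to `∐_ω U_ω → S`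
  (countably many countable summands).

Plain category theory of `Π`-sets; no statement of the paper is strengthened.
-/

open CategoryTheory Topology

namespace Literature.AnabelianGeometry.SemiGraphs

open Literature.AlgebraicGeometry.Frobenioids.QuasiTemperoid.BTempConnected (hom_ρ hom_ext_apply
  ρ_one_apply ρ_mul_apply ρ_inv_apply)

universe u

namespace BTemp

variable {G : Type u} [Group G] [TopologicalSpace G]

/-! ### Orbits of an object of `B^temp(Π)` as objects -/

/-- The set of `Π`-orbits of (the points of) `S`. [cite: MochizukiSemiAnbd2006, §2 p.23] -/
abbrev Orbits (S : BTemp G) : Type u :=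
  Quot fun s s' : S.obj.V => ∃ g : G, S.obj.ρ g s = s'

/-- The orbit class of a point. [cite: MochizukiSemiAnbd2006, §2 p.23] -/
abbrev cl (S : BTemp G) (s : S.obj.V) : Orbits S := Quot.mk _ s

/-- The class of `g · s` is the class of `s`. [cite: MochizukiSemiAnbd2006, §2 p.23] -/
theorem cl_ρ (S : BTemp G) (g : G) (s : S.obj.V) : cl S (S.obj.ρ g s) = cl S s :=
  (Quot.sound ⟨g, rfl⟩).symm

/-- Two points have the same class iff they lie in one orbit. [cite: MochizukiSemiAnbd2006, §2 p.23] -/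
theorem cl_eq_cl_iff (S : BTemp G) (s s' : S.obj.V) : cl S s = cl S s' ↔ ∃ g : G, S.obj.ρ g s = s' := by
  have key : ∀ a b : S.obj.V,
      Relation.EqvGen (fun s s' : S.obj.V => ∃ g : G, S.obj.ρ g s = s') a b →
        ∃ g : G, S.obj.ρ g a = b := by
    intro a b hab
    induction hab with
    | rel a b hab => exact hab
    | refl a => exact ⟨1, ρ_one_apply S a⟩
    | symm a b _ ih =>
      obtain ⟨g, hg⟩ := ih
      exact ⟨g⁻¹, by rw [← hg, ρ_inv_apply]⟩
    | trans a b c _ _ ih₁ ih₂ =>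
      obtain ⟨g, hg⟩ := ih₁
      obtain ⟨h, hh⟩ := ih₂
      exact ⟨h * g, by rw [ρ_mul_apply, hg, hh]⟩
  constructor
  · intro h
    exact key _ _ (Quot.eqvGen_exact h)
  · rintro ⟨g, rfl⟩
    exact (cl_ρ S g s).symm

/-- The points of the orbit `ω` of `S`. [cite: MochizukiSemiAnbd2006, §2 p.23] -/
abbrev OrbitPts (S : BTemp G) (ω : Orbits S) : Type u := {s : S.obj.V // cl S s = ω}

/-- The orbit `ω` of `S` as an object of `B^temp(Π)` ("the connected components" of a covering over
a constituent anabelioid, §2 p. 23 / §3 p. 37). [cite: MochizukiSemiAnbd2006, Def 3.5(i) p.37] -/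
noncomputable def orbitPart (S : BTemp G) (ω : Orbits S) : BTemp G :=
  letI : MulAction G (OrbitPts S ω) :=
    { smul := fun g x => ⟨S.obj.ρ g x.1, (cl_ρ S g x.1).trans x.2⟩
      one_smul := fun x => Subtype.ext (ρ_one_apply S x.1)
      mul_smul := fun g h x => Subtype.ext (ρ_mul_apply S g h x.1) }
  ⟨Action.ofMulAction G (OrbitPts S ω), by
    haveI : Countable S.obj.V := S.property.1
    refine ⟨inferInstanceAs (Countable (OrbitPts S ω)), fun x => ?_⟩
    have : {g : G | (Action.ofMulAction G (OrbitPts S ω)).ρ g x = x} =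
        {g : G | S.obj.ρ g x.1 = x.1} := by
      ext g
      exact Subtype.ext_iff
    rw [this]
    exact S.property.2 x.1⟩

/-- The action on an orbit part, on points. [cite: MochizukiSemiAnbd2006, Def 3.5(i) p.37] -/
theorem orbitPart_ρ (S : BTemp G) (ω : Orbits S) (g : G) (x : OrbitPts S ω) :
    ((orbitPart S ω).obj.ρ g x).1 = S.obj.ρ g x.1 :=
  rfl

/-- The inclusion of an orbit into `S`. [cite: MochizukiSemiAnbd2006, Def 3.5(i) p.37] -/
noncomputable def orbitPartι (S : BTemp G) (ω : Orbits S) : orbitPart S ω ⟶ S :=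
  ObjectProperty.homMk
    { hom := TypeCat.ofHom fun x : OrbitPts S ω => (x.1 : S.obj.V)
      comm := fun g => by
        apply ConcreteCategory.hom_ext
        intro x
        rfl }

/-! ### The part of an object over `S` lying over an orbit -/

/-- For `T → S` and an orbit `ω` of `S`: the points of `T` over `ω`.
[cite: MochizukiSemiAnbd2006, Prop 3.6(v) p.39] -/
abbrev FibrePts {S : BTemp G} (T : Over S) (ω : Orbits S) : Type u :=
  {t : T.left.obj.V // cl S (T.hom.hom.hom t) = ω}

/-- The image in `S` of a translate: `T.hom (g · t)` has the class of `T.hom t`.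
[cite: MochizukiSemiAnbd2006, Prop 3.6(v) p.39] -/
theorem cl_hom_ρ {S : BTemp G} (T : Over S) (g : G) (t : T.left.obj.V) :
    cl S (T.hom.hom.hom (T.left.obj.ρ g t)) = cl S (T.hom.hom.hom t) := by
  rw [hom_ρ, cl_ρ]

/-- `T ×_S S_ω`, the part of `T` over the orbit `ω`, as an object of `B^temp(Π)`.
[cite: MochizukiSemiAnbd2006, Prop 3.6(v) p.39] -/
noncomputable def fibrePart {S : BTemp G} (T : Over S) (ω : Orbits S) : BTemp G :=
  letI : MulAction G (FibrePts T ω) :=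
    { smul := fun g x => ⟨T.left.obj.ρ g x.1, (cl_hom_ρ T g x.1).trans x.2⟩
      one_smul := fun x => Subtype.ext (ρ_one_apply T.left x.1)
      mul_smul := fun g h x => Subtype.ext (ρ_mul_apply T.left g h x.1) }
  ⟨Action.ofMulAction G (FibrePts T ω), by
    haveI : Countable T.left.obj.V := T.left.property.1
    refine ⟨inferInstanceAs (Countable (FibrePts T ω)), fun x => ?_⟩
    have : {g : G | (Action.ofMulAction G (FibrePts T ω)).ρ g x = x} =
        {g : G | T.left.obj.ρ g x.1 = x.1} := by
      ext g
      exact Subtype.ext_iff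
    rw [this]
    exact T.left.property.2 x.1⟩

/-- The action on a fibre part, on points. [cite: MochizukiSemiAnbd2006, Prop 3.6(v) p.39] -/
theorem fibrePart_ρ {S : BTemp G} (T : Over S) (ω : Orbits S) (g : G) (x : FibrePts T ω) :
    ((fibrePart T ω).obj.ρ g x).1 = T.left.obj.ρ g x.1 :=
  rfl

/-- The structure map `T ×_S S_ω → S_ω`. [cite: MochizukiSemiAnbd2006, Prop 3.6(v) p.39] -/
noncomputable def fibrePartHom {S : BTemp G} (T : Over S) (ω : Orbits S) :
    fibrePart T ω ⟶ orbitPart S ω :=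
  ObjectProperty.homMk
    { hom := TypeCat.ofHom fun x : FibrePts T ω => (⟨T.hom.hom.hom x.1, x.2⟩ : OrbitPts S ω)
      comm := fun g => by
        apply ConcreteCategory.hom_ext
        intro x
        apply Subtype.ext
        exact hom_ρ T.hom g x.1 }

/-- The structure map on points. [cite: MochizukiSemiAnbd2006, Prop 3.6(v) p.39] -/
theorem fibrePartHom_apply {S : BTemp G} (T : Over S) (ω : Orbits S) (x : FibrePts T ω) :
    ((fibrePartHom T ω).hom.hom x).1 = T.hom.hom.hom x.1 := rfl

/-! ### The comparison functor `Over S ⥤ ∏_ω Over S_ω` -/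

/-- **The decomposition functor** `T ↦ (T ×_S S_ω)_ω`. [cite: MochizukiSemiAnbd2006, Prop 3.6(v) p.39] -/
noncomputable def overToPi (S : BTemp G) :
    Over S ⥤ ∀ ω : Orbits S, Over (orbitPart S ω) where
  obj T := fun ω => Over.mk (fibrePartHom T ω)
  map {T T'} f := fun ω => Over.homMk
    (ObjectProperty.homMk
      { hom := TypeCat.ofHom fun x : FibrePts T ω =>
          (⟨f.left.hom.hom x.1, by
            have := congrArg (fun k : T.left ⟶ S => (k.hom.hom x.1 : S.obj.V)) (Over.w f)
            simp only at this
            change cl S ((f.left ≫ T'.hom).hom.hom x.1) = ω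
            rw [this]
            exact x.2⟩ : FibrePts T' ω)
        comm := fun g => by
          apply ConcreteCategory.hom_ext
          intro x
          apply Subtype.ext
          exact hom_ρ f.left g x.1 })
    (by
      apply hom_ext_apply
      intro x
      apply Subtype.ext
      change (T'.hom.hom.hom (f.left.hom.hom x.1) : S.obj.V) = T.hom.hom.hom x.1
      exact congrArg (fun k : T.left ⟶ S => (k.hom.hom x.1 : S.obj.V)) (Over.w f))
  map_id T := by
    funext ω
    apply Over.OverMorphism.ext
    apply hom_ext_apply
    intro x
    rfl
  map_comp f g := by
    funext ω
    apply Over.OverMorphism.ext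
    apply hom_ext_apply
    intro x
    rfl

/-- The decomposition functor on points. [cite: MochizukiSemiAnbd2006, Prop 3.6(v) p.39] -/
theorem overToPi_map_apply {S : BTemp G} {T T' : Over S} (f : T ⟶ T')
    (ω : Orbits S) (x : FibrePts T ω) :
    (((overToPi S).map f ω).left.hom.hom x).1 = f.left.hom.hom x.1 :=
  rfl

/-! ### Isomorphisms of `B^temp(Π)` from equivariant bijections -/

/-- An equivariant bijection is an isomorphism of `B^temp(Π)` (the inverse map is automatically
equivariant). [cite: MochizukiSemiAnbd2006, §3 p.33] -/
noncomputable def isoOfBijective {X Y : BTemp G} (f : X ⟶ Y)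
    (hf : Function.Bijective fun x : X.obj.V => (f.hom.hom x : Y.obj.V)) : X ≅ Y where
  hom := f
  inv := ObjectProperty.homMk
    { hom := TypeCat.ofHom (Equiv.ofBijective _ hf).symm
      comm := fun g => by
        apply ConcreteCategory.hom_ext
        intro y
        change (Equiv.ofBijective _ hf).symm (Y.obj.ρ g y) = X.obj.ρ g ((Equiv.ofBijective _ hf).symm y)
        apply hf.1
        change (f.hom.hom ((Equiv.ofBijective _ hf).symm (Y.obj.ρ g y)) : Y.obj.V) =
          f.hom.hom (X.obj.ρ g ((Equiv.ofBijective _ hf).symm y))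
        rw [hom_ρ]
        exact ((Equiv.ofBijective _ hf).apply_symm_apply (Y.obj.ρ g y)).trans
          (congrArg (Y.obj.ρ g) ((Equiv.ofBijective _ hf).apply_symm_apply y).symm) }
  hom_inv_id := hom_ext_apply fun x => (Equiv.ofBijective _ hf).symm_apply_apply x
  inv_hom_id := hom_ext_apply fun y => (Equiv.ofBijective _ hf).apply_symm_apply y

/-! ### The decomposition functor is an equivalence -/

/-- `T ↦ (T ×_S S_ω)_ω` is faithful: a morphism over `S` is determined by its restrictions to the
parts over the orbits. [cite: MochizukiSemiAnbd2006, Prop 3.6(v) p.39] -/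
theorem overToPi_faithful (S : BTemp G) : (overToPi S).Faithful :=
  ⟨fun {T T'} f f' h => by
    apply Over.OverMorphism.ext
    apply hom_ext_apply
    intro t
    exact congrArg (fun k : (overToPi S).obj T ⟶ (overToPi S).obj T' =>
      (((k (cl S (T.hom.hom.hom t))).left.hom.hom (⟨t, rfl⟩ : FibrePts T _)).1 : T'.left.obj.V)) h⟩

/-- `T ↦ (T ×_S S_ω)_ω` is full: a compatible family of morphisms over the orbits glues to a
morphism over `S`. [cite: MochizukiSemiAnbd2006, Prop 3.6(v) p.39] -/
theorem overToPi_full (S : BTemp G) : (overToPi S).Full :=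
  ⟨fun {T T'} η => by
    -- the glued map and its description on each part
    let fl : T.left.obj.V → T'.left.obj.V := fun t =>
      (((η (cl S (T.hom.hom.hom t))).left.hom.hom (⟨t, rfl⟩ : FibrePts T _)).1 : T'.left.obj.V)
    have key : ∀ (ω : Orbits S) (x : FibrePts T ω),
        (((η ω).left.hom.hom x).1 : T'.left.obj.V) = fl x.1 := by
      rintro ω ⟨t, h⟩
      subst h
      rfl
    have hfl : ∀ (g : G) (t : T.left.obj.V), fl (T.left.obj.ρ g t) = T'.left.obj.ρ g (fl t) := by
      intro g t
      have e1 := key (cl S (T.hom.hom.hom t))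
        ((fibrePart T (cl S (T.hom.hom.hom t))).obj.ρ g (⟨t, rfl⟩ : FibrePts T _))
      have e2 := congrArg Subtype.val
        (hom_ρ (η (cl S (T.hom.hom.hom t))).left g (⟨t, rfl⟩ : FibrePts T _))
      exact e1.symm.trans e2
    have hw : ∀ t : T.left.obj.V, (T'.hom.hom.hom (fl t) : S.obj.V) = T.hom.hom.hom t := fun t =>
      congrArg (fun k : fibrePart T (cl S (T.hom.hom.hom t)) ⟶ orbitPart S _ =>
        ((k.hom.hom (⟨t, rfl⟩ : FibrePts T _)).1 : S.obj.V)) (Over.w (η (cl S (T.hom.hom.hom t))))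
    refine ⟨Over.homMk (ObjectProperty.homMk
      { hom := TypeCat.ofHom fl
        comm := fun g => by
          apply ConcreteCategory.hom_ext
          intro t
          exact hfl g t }) (hom_ext_apply fun t => hw t), ?_⟩
    funext ω
    apply Over.OverMorphism.ext
    apply hom_ext_apply
    intro x
    apply Subtype.ext
    exact (key ω x).symm⟩

/-- `T ↦ (T ×_S S_ω)_ω` is essentially surjective: a family `(U_ω → S_ω)_ω` is the decomposition of
`∐_ω U_ω → S` (a countable disjoint union of countable `Π`-sets with open stabilisers).
[cite: MochizukiSemiAnbd2006, Prop 3.6(v) p.39] -/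
theorem overToPi_essSurj (S : BTemp G) : (overToPi S).EssSurj :=
  ⟨fun U => by
    classical
    letI : ∀ ω : Orbits S, MulAction G ((U ω).left.obj.V) := fun ω =>
      Action.instMulAction (U ω).left.obj
    haveI : Countable S.obj.V := S.property.1
    haveI : ∀ ω : Orbits S, Countable ((U ω).left.obj.V) := fun ω => (U ω).left.property.1
    -- the glued object `∐_ω U_ω`
    let C : Type u := Σ ω : Orbits S, (U ω).left.obj.V
    let TB : BTemp G := ⟨Action.ofMulAction G C, by
      refine ⟨inferInstanceAs (Countable C), fun p => ?_⟩
      obtain ⟨ω, u⟩ := p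
      have : {g : G | (Action.ofMulAction G C).ρ g (⟨ω, u⟩ : C) = ⟨ω, u⟩} =
          {g : G | (U ω).left.obj.ρ g u = u} := by
        ext g
        simp only [Set.mem_setOf_eq]
        change g • (⟨ω, u⟩ : C) = ⟨ω, u⟩ ↔ g • u = u
        rw [Sigma.smul_mk, Sigma.mk.inj_iff]
        exact ⟨fun h => eq_of_heq h.2, fun h => ⟨rfl, heq_of_eq h⟩⟩
      rw [this]
      exact (U ω).left.property.2 u⟩
    have hTBρ : ∀ (g : G) (ω : Orbits S) (u : (U ω).left.obj.V),
        TB.obj.ρ g (⟨ω, u⟩ : C) = ⟨ω, (U ω).left.obj.ρ g u⟩ := fun g ω u => rfl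
    -- its structure map to `S`
    let hT : TB ⟶ S := ObjectProperty.homMk
      { hom := TypeCat.ofHom fun p : C => (((U p.1).hom.hom.hom p.2).1 : S.obj.V)
        comm := fun g => by
          apply ConcreteCategory.hom_ext
          rintro ⟨ω, u⟩
          change (((U ω).hom.hom.hom ((U ω).left.obj.ρ g u)).1 : S.obj.V) =
            S.obj.ρ g ((U ω).hom.hom.hom u).1
          rw [hom_ρ]
          rfl }
    let T₀ : Over S := Over.mk hT
    -- the comparison `U_ω ≅ T₀ ×_S S_ω`, `u ↦ ⟨ω, u⟩`
    let ψ : ∀ ω : Orbits S, (U ω).left ⟶ fibrePart T₀ ω := fun ω => ObjectProperty.homMk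
      { hom := TypeCat.ofHom fun u => (⟨(⟨ω, u⟩ : C), ((U ω).hom.hom.hom u).2⟩ : FibrePts T₀ ω)
        comm := fun g => by
          apply ConcreteCategory.hom_ext
          intro u
          rfl }
    have hψ : ∀ ω, Function.Bijective fun u : (U ω).left.obj.V =>
        ((ψ ω).hom.hom u : FibrePts T₀ ω) := by
      intro ω
      constructor
      · intro u u' h
        have h1 : (⟨ω, u⟩ : C) = ⟨ω, u'⟩ := congrArg Subtype.val h
        exact eq_of_heq (Sigma.mk.inj_iff.mp h1).2
      · rintro ⟨⟨ω', u⟩, h⟩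
        have hω : ω' = ω := (((U ω').hom.hom.hom u).2).symm.trans h
        subst hω
        exact ⟨u, rfl⟩
    let e : ∀ ω : Orbits S, U ω ≅ (overToPi S).obj T₀ ω := fun ω =>
      Over.isoMk (isoOfBijective (ψ ω) (hψ ω)) (hom_ext_apply fun u => rfl)
    exact ⟨T₀, ⟨{ hom := fun ω => (e ω).inv
                  inv := fun ω => (e ω).hom
                  hom_inv_id := by
                    funext ω
                    exact (e ω).inv_hom_id
                  inv_hom_id := by
                    funext ω
                    exact (e ω).hom_inv_id }⟩⟩⟩

/-- **`Over S ≌ ∏_ω Over S_ω`**: the decomposition functor is an equivalence of categories.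
[cite: MochizukiSemiAnbd2006, Prop 3.6(v) p.39] -/
theorem overToPi_isEquivalence (S : BTemp G) : (overToPi S).IsEquivalence :=
  haveI := overToPi_faithful S
  haveI := overToPi_full S
  haveI := overToPi_essSurj S
  { }

/-- **The fibrewise decomposition of a slice of `B^temp(Π)`** along the orbits of the base:
`B^temp(Π)_S ≌ ∏_{ω} B^temp(Π)_{S_ω}` — the single-vertex layer of [SemiAnbd] Prop. 3.6 (v)
(the vertices of the covering semi-graph over `v` are the orbits `ω` of `S_v`; over each,
induction `B^temp(Π)_{S_ω} ≃ B^temp(Stab)` is [FrdII] Ex. 1.3 (i) / `InductionEquivalence`).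
[cite: MochizukiSemiAnbd2006, Prop 3.6(v) p.39] -/
noncomputable def overEquivPiOver (S : BTemp G) : Over S ≌ ∀ ω : Orbits S, Over (orbitPart S ω) :=
  haveI := overToPi_isEquivalence S
  (overToPi S).asEquivalence

end BTemp

end Literature.AnabelianGeometry.SemiGraphs
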